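import Literature.NumberTheory.Rogawski1990.ArchStableOrbitalWallStepOrbitMeasure   -- ★ (R1-e′) p841391: the unweighted one-step jump + its §1∕§2 readings (`integral_pi_update_*`), brings ★ J1-CM, ★ `archLimitFormulaNoncompactWall_holds`
import HarnessLib

/-!
# The one-step jump of the «method of §8.2» at a place `w`, ONE RELABELLING `ρ` AT A TIME (so that the κ-weights of `Δ″_∞` ride through)
# (Rogawski 1990 Prop. 8.2.1 (a) pp. 118–119, §8.2 pp. 122–124, §14.5 Lemma 14.5.2 (b) pp. 238–239)

Cell `pub/hodgecm-mathlib`, Track B «K2-LIT», engine K2·E4, socket #11 `sig_K2E4ArchSingularKernel` ∕ #9 `sig_K2E4ExplicitArchSingularTransfer` of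
`Cruxes/H413/Lines/K2_E4_SingularTransferKappaSignSigsArchLimitConstant.lean` (crux H413 = `stmt-HodgeConjecture-24833`); brick G1 of the V2 «G′ PACKAGE» (K2E4-p11 for the assembler
K2E4-p09; lands `--supports stmt-HodgeConjecture-24833`).

WHY.  On the `G′`-side of the endoscopic singular transfer the relabelled partners `t(z∘ρ)` of an `H`-point enter (4.3.1) WEIGHTED by the κ-signs `K_ρ = Π_v k_v(ρ_v)` of Rogawski's
explicit factor `Δ″_∞` (★ `archExplicitDelta`: `k_v(ρ_v) = sgn re σ_v(α_{ρ_v⁻¹1}) · η_v`), so the place-by-place descent (★ `K2E4ArchSingularKernelPlaceInduction.eq_of_step_of_regular_eq`)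
needs the one-step jump for `Σ_{ρ∈S₃} k(ρ) · (term of ρ)` and not only for the plain six-term sum of ★ J1 (`exists_tendsto_deriv_sin_mul_sum_integral_comp_conj_splitCurve_comp_perm`) ∕
★ (R1-e′) (`exists_tendsto_deriv_sin_mul_sum_integral_pi_update_splitCurve`).  Both ★ proofs are termwise (transport of the term of `ρ` to the standard curve on `G_w(α∘ρ⁻¹)`,
★ `sin_mul_integral_comp_conj_splitCurve_comp_perm_eq`; the letter ★ `archLimitFormulaNoncompactWall_holds` at a noncompact wall, ★ `tendsto_deriv_sin_smul_integral_compactWall` at a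
compact one), so the weights ride through once the statements are available PER PARTNER: THIS FILE re-threads both ★ proofs for ONE `ρ` (SAME constants `c τ` — the letter's, independent of `Θ`,
`z₀`, `ρ` and the other-place measures); §1 is the termwise-derivative bookkeeping a weighted consumer adds.

* §1 `eventually_deriv_weightedPartnerSum_eq` — `∂(2 sin ψ · Σ_ρ k_ρ F_ρ) = Σ_ρ k_ρ ∂(2 sin ψ · F_ρ)` on the window `ψ → 0+`.
* §2 **`exists_wallJump_partner`** — ★ J1 ONE RELABELLING AT A TIME, unconditional for CM `L`:
  `∂_ψ[2 sin ψ · ∫ Θ(g·diag(z_ψ∘ρ)·g⁻¹) dν] ⟶ (cpt ? 2·F_Θ(z₀∘ρ) : c_{ρ⁻¹}·S_{ρ⁻¹}(Θ, z₀))` along `𝓝[>] 0` — so that ANY weights `k_ρ` ride through (`tendsto_finsetSum` + §1).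
* §3 **`exists_wallJump_partner_orbitMeasure`** — ★ (R1-e′) ONE RELABELLING AT A TIME (all-places orbit-measure currency, arbitrary Radon measures at the
  other places): the per-partner `hstep` input of the κ-weighted `G′`-state family `B(S, u)` of the V2 package (jump coefficients `κ_w(ρ) = (cw ? 2 : c_{ρ⁻¹})` and wall measures = ★ (R1-e′)'s, verbatim).
HONEST LABEL: HC_CM is proved only modulo the 7 printed citations (2 remaining named inputs: hLiu418 = stmt-HodgeConjecture-24832, h413 = stmt-HodgeConjecture-24833) until rung 0
closes; this file re-threads ★ J1 ∕ ★ (R1-e′) and pays nothing by itself.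

## References
* [Rogawski1990] J. D. Rogawski, *Automorphic Representations of Unitary Groups in Three Variables*, Ann. of Math. Stud. 123 (1990), Prop. 8.2.1 (a) pp. 118–119 («the limit formulas
  for `H` and `H′`»), §8.2 pp. 122–124, §14.5 Lemma 14.5.2 (b) pp. 238–239.
* [Varadarajan1989] V. S. Varadarajan, *An Introduction to Harmonic Analysis on Semisimple Lie Groups* (1989), §6.4 Thm 22.
* [BorelJacquet1979] A. Borel, H. Jacquet, *Automorphic forms and automorphic representations*, PSPM 33.1 (1979), §4.1.
* [DeitmarEchterhoff2014] A. Deitmar, S. Echterhoff, *Principles of Harmonic Analysis*, 2nd ed. (2014), Lemma 9.3.3, Thm. 1.5.3.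
-/

set_option autoImplicit false
set_option linter.dupNamespace false  -- the cell's namespace convention `Summit.HodgeConjecture.HodgeConjecture.Cruxes.H413.<File>` repeats the summit = problem name

noncomputable section

open MeasureTheory Measure Filter Topology NumberField NumberField.InfinitePlace NumberField.mixedEmbedding Equiv Function Set
open Literature.MeasureTheory.Group Literature.NumberTheory.Automorphic Literature.NumberTheory.Automorphic.UnitaryGroup
open Literature.LinearAlgebra.Matrix Literature.NumberTheory.Rogawski1990
open scoped Matrix MatrixGroups Matrix.Norms.Operator ContDiff

namespace Summit.HodgeConjecture.HodgeConjecture.Cruxes.H413.K2E4ArchPartnerWallJump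

/-! ## §1 `deriv (2 sin ψ · Σ_ρ k_ρ F_ρ) = Σ_ρ k_ρ deriv (2 sin ψ · F_ρ)` on the window -/

section Terms

variable (L : Type) [Field L] (α : Fin 3 → L) (w : {w : InfinitePlace L // IsComplex w})
  [MeasurableSpace (GL (Fin 3) ℂ)] [BorelSpace (GL (Fin 3) ℂ)]

/-- **`deriv (2 sin ψ · Σ_ρ k_ρ F_ρ) = Σ_ρ k_ρ · deriv (2 sin ψ · F_ρ)` FOR ALL SMALL `ψ > 0`** (every term differentiable at the regular parameters, ★
`differentiableAt_integral_comp_conj_splitCurve_comp_perm`, ★ `eventually_injective_splitCurve`). [cite: Rogawski1990, §8.2 p. 124] -/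
theorem eventually_deriv_weightedPartnerSum_eq (hα : ∀ i, α i ≠ 0) (hreal : ∀ i, (w.1.embedding (α i)).im = 0)
    (ν : Measure (archLocal L 3 (Matrix.diagonal α) w)) [IsFiniteMeasureOnCompacts ν]
    (Θ : Matrix (Fin 3) (Fin 3) ℂ → ℂ) (hΘ : ContDiff ℝ 1 Θ)
    (hΘc : HasCompactSupport fun k : archLocal L 3 (Matrix.diagonal α) w => Θ (((k : GL (Fin 3) ℂ) : Matrix (Fin 3) (Fin 3) ℂ)))
    (k : Perm (Fin 3) → ℂ) {z₀ : Fin 3 → Circle} (h02' : z₀ 0 = z₀ 2) (h01' : z₀ 0 ≠ z₀ 1) :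
    ∀ᶠ ψ in 𝓝[>] (0 : ℝ),
      deriv (fun ψ : ℝ => (2 * Real.sin ψ : ℂ) * ∑ ρ : Perm (Fin 3), k ρ * ∫ g : archLocal L 3 (Matrix.diagonal α) w,
          Θ ((((g * ⟨circleDiagonal 3 ((fun i => z₀ i * Circle.exp (![(1 : ℝ), 0, -1] i * ψ)) ∘ ⇑ρ), circleDiagonal_mem_archLocal_diagonal L 3 α w _⟩ * g⁻¹ :
            archLocal L 3 (Matrix.diagonal α) w) : GL (Fin 3) ℂ) : Matrix (Fin 3) (Fin 3) ℂ)) ∂ν) ψ =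
        ∑ ρ : Perm (Fin 3), k ρ * deriv (fun ψ : ℝ => (2 * Real.sin ψ : ℂ) * ∫ g : archLocal L 3 (Matrix.diagonal α) w,
          Θ ((((g * ⟨circleDiagonal 3 ((fun i => z₀ i * Circle.exp (![(1 : ℝ), 0, -1] i * ψ)) ∘ ⇑ρ), circleDiagonal_mem_archLocal_diagonal L 3 α w _⟩ * g⁻¹ :
            archLocal L 3 (Matrix.diagonal α) w) : GL (Fin 3) ℂ) : Matrix (Fin 3) (Fin 3) ℂ)) ∂ν) ψ := by
  have hev : ∀ᶠ ψ in 𝓝[>] (0 : ℝ), Function.Injective fun i => z₀ i * Circle.exp (![(1 : ℝ), 0, -1] i * ψ) :=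
    (eventually_injective_splitCurve z₀ h02' h01').filter_mono (nhdsWithin_mono _ fun x hx => ne_of_gt hx)
  filter_upwards [hev] with ψ hψ
  have hsin : DifferentiableAt ℝ (fun ψ : ℝ => (2 * Real.sin ψ : ℂ)) ψ :=
    (((Real.hasDerivAt_sin ψ).ofReal_comp).const_mul (2 : ℂ)).differentiableAt
  have hterm : ∀ ρ : Perm (Fin 3), DifferentiableAt ℝ (fun ψ : ℝ => (2 * Real.sin ψ : ℂ) * ∫ g : archLocal L 3 (Matrix.diagonal α) w,
      Θ ((((g * ⟨circleDiagonal 3 ((fun i => z₀ i * Circle.exp (![(1 : ℝ), 0, -1] i * ψ)) ∘ ⇑ρ), circleDiagonal_mem_archLocal_diagonal L 3 α w _⟩ * g⁻¹ :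
        archLocal L 3 (Matrix.diagonal α) w) : GL (Fin 3) ℂ) : Matrix (Fin 3) (Fin 3) ℂ)) ∂ν) ψ := fun ρ =>
    hsin.mul (differentiableAt_integral_comp_conj_splitCurve_comp_perm L α w hα hreal ν Θ hΘ hΘc z₀ ρ hψ)
  have hterm' : ∀ ρ : Perm (Fin 3), DifferentiableAt ℝ (fun ψ : ℝ => k ρ * ((2 * Real.sin ψ : ℂ) * ∫ g : archLocal L 3 (Matrix.diagonal α) w,
      Θ ((((g * ⟨circleDiagonal 3 ((fun i => z₀ i * Circle.exp (![(1 : ℝ), 0, -1] i * ψ)) ∘ ⇑ρ), circleDiagonal_mem_archLocal_diagonal L 3 α w _⟩ * g⁻¹ :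
        archLocal L 3 (Matrix.diagonal α) w) : GL (Fin 3) ℂ) : Matrix (Fin 3) (Fin 3) ℂ)) ∂ν)) ψ := fun ρ => (hterm ρ).const_mul (k ρ)
  have hfun : (fun ψ : ℝ => (2 * Real.sin ψ : ℂ) * ∑ ρ : Perm (Fin 3), k ρ * ∫ g : archLocal L 3 (Matrix.diagonal α) w,
      Θ ((((g * ⟨circleDiagonal 3 ((fun i => z₀ i * Circle.exp (![(1 : ℝ), 0, -1] i * ψ)) ∘ ⇑ρ), circleDiagonal_mem_archLocal_diagonal L 3 α w _⟩ * g⁻¹ :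
        archLocal L 3 (Matrix.diagonal α) w) : GL (Fin 3) ℂ) : Matrix (Fin 3) (Fin 3) ℂ)) ∂ν) =
      ∑ ρ : Perm (Fin 3), fun ψ : ℝ => k ρ * ((2 * Real.sin ψ : ℂ) * ∫ g : archLocal L 3 (Matrix.diagonal α) w,
        Θ ((((g * ⟨circleDiagonal 3 ((fun i => z₀ i * Circle.exp (![(1 : ℝ), 0, -1] i * ψ)) ∘ ⇑ρ), circleDiagonal_mem_archLocal_diagonal L 3 α w _⟩ * g⁻¹ :
          archLocal L 3 (Matrix.diagonal α) w) : GL (Fin 3) ℂ) : Matrix (Fin 3) (Fin 3) ℂ)) ∂ν) := by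
    funext ψ
    rw [Finset.sum_apply, Finset.mul_sum]
    exact Finset.sum_congr rfl fun ρ _ => by ring
  rw [hfun, deriv_sum fun ρ _ => hterm' ρ]
  exact Finset.sum_congr rfl fun ρ _ => deriv_const_mul (k ρ) (hterm ρ)

end Terms

/-! ## §2 Weighted J1 (CM field, unconditional) -/

section Junction

variable (L : Type) [Field L] [NumberField L] [IsCMField L] (α : Fin 3 → L) (w : {w : InfinitePlace L // IsComplex w})
  [MeasurableSpace (GL (Fin 3) ℂ)] [BorelSpace (GL (Fin 3) ℂ)]

/-- **THE WALL JUMP OF ONE NONCOMPACT PARTNER — `∂_ψ[2 sin ψ · F_Θ(z_ψ ∘ ρ)] → c_{ρ⁻¹} · S_{ρ⁻¹}(Θ, z₀)`**, CM field `L` (the (J-nc) letter discharged by ★ `archLimitFormulaNoncompactWall_holds`):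
for a relabelling `ρ` whose `w`-wall `{ρ⁻¹0, ρ⁻¹2}` is NONCOMPACT there is ONE constant `c ≠ 0` (the letter's on `G_w(α∘ρ⁻¹)` for the transported Haar measure and `νH`;
independent of `Θ`, `z₀`) with limit `c ·` the letter's singular orbital integral of the transported `Θ` (★ `sin_mul_integral_comp_conj_splitCurve_comp_perm_eq`), plus
differentiability at the regular parameters.  Print's `γ, γ₁ → γ₀`.  Weighted sums `Σ_ρ k_ρ(…)` follow by `tendsto_finsetSum` + §1.
[cite: Rogawski1990, §8.2 p. 124; Prop. 8.2.1 (a) p. 119] [cite: Varadarajan1989, §6.4 Thm 22] -/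
theorem exists_const_tendsto_deriv_wallJump_partner_noncompact
    (hα : ∀ i, α i ≠ 0) (hreal : ∀ i, (w.1.embedding (α i)).im = 0)
    (ν : Measure (archLocal L 3 (Matrix.diagonal α) w)) [ν.IsHaarMeasure] [ν.IsMulRightInvariant]
    (ρ : Perm (Fin 3)) (hρ : (w.1.embedding (α (ρ⁻¹ 0))).re * (w.1.embedding (α (ρ⁻¹ 2))).re < 0)
    (z₁ : Fin 3 → Circle) (h02 : z₁ 0 = z₁ 2) (h01 : z₁ 0 ≠ z₁ 1)
    [MeasurableSpace (archLocal L 3 (Matrix.diagonal (α ∘ ⇑ρ⁻¹)) w ⧸ Subgroup.centralizer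
      ({(⟨circleDiagonal 3 z₁, circleDiagonal_mem_archLocal_diagonal L 3 (α ∘ ⇑ρ⁻¹) w z₁⟩ : archLocal L 3 (Matrix.diagonal (α ∘ ⇑ρ⁻¹)) w)} :
        Set (archLocal L 3 (Matrix.diagonal (α ∘ ⇑ρ⁻¹)) w)))]
    [BorelSpace (archLocal L 3 (Matrix.diagonal (α ∘ ⇑ρ⁻¹)) w ⧸ Subgroup.centralizer
      ({(⟨circleDiagonal 3 z₁, circleDiagonal_mem_archLocal_diagonal L 3 (α ∘ ⇑ρ⁻¹) w z₁⟩ : archLocal L 3 (Matrix.diagonal (α ∘ ⇑ρ⁻¹)) w)} :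
        Set (archLocal L 3 (Matrix.diagonal (α ∘ ⇑ρ⁻¹)) w)))]
    (νH : Measure (Subgroup.centralizer
      ({(⟨circleDiagonal 3 z₁, circleDiagonal_mem_archLocal_diagonal L 3 (α ∘ ⇑ρ⁻¹) w z₁⟩ : archLocal L 3 (Matrix.diagonal (α ∘ ⇑ρ⁻¹)) w)} :
        Set (archLocal L 3 (Matrix.diagonal (α ∘ ⇑ρ⁻¹)) w))))
    [νH.IsHaarMeasure] [νH.IsInvInvariant] :
    haveI : LocallyCompactSpace (archLocal L 3 (Matrix.diagonal (α ∘ ⇑ρ⁻¹)) w) := locallyCompactSpace_archLocal L 3 (Matrix.diagonal (α ∘ ⇑ρ⁻¹)) w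
    haveI : SecondCountableTopology (archLocal L 3 (Matrix.diagonal (α ∘ ⇑ρ⁻¹)) w) := secondCountableTopology_archLocal L 3 (Matrix.diagonal (α ∘ ⇑ρ⁻¹)) w
    haveI : (ν.map (ContinuousMulEquiv.restrictSubgroup (GLn.conjEquiv (Matrix.GeneralLinearGroup.mkOfDetNeZero _ (det_monomial_one_ne_zero 3 ρ⁻¹)))
        (archLocal L 3 (Matrix.diagonal (α ∘ ⇑ρ⁻¹)) w) (archLocal L 3 (Matrix.diagonal α) w)
        (mem_archLocal_comp_perm_iff_conj_mem L 3 α w ρ⁻¹)).symm).IsMulRightInvariant := isMulRightInvariant_map_relabel_symm L 3 α w ρ⁻¹ ν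
    ∃ c : ℂ, c ≠ 0 ∧
      ∀ (Θ : Matrix (Fin 3) (Fin 3) ℂ → ℂ), ContDiff ℝ (⊤ : ℕ∞) Θ →
        HasCompactSupport (fun k : archLocal L 3 (Matrix.diagonal α) w => Θ ((k : GL (Fin 3) ℂ) : Matrix (Fin 3) (Fin 3) ℂ)) →
        ∀ (z₀ : Fin 3 → Circle) (h02' : z₀ 0 = z₀ 2) (h01' : z₀ 0 ≠ z₀ 1),
          (∀ ψ : ℝ, Function.Injective (fun i => z₀ i * Circle.exp (![(1 : ℝ), 0, -1] i * ψ)) → DifferentiableAt ℝ (fun ψ : ℝ => (2 * Real.sin ψ : ℂ) * ∫ g : archLocal L 3 (Matrix.diagonal α) w,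
              Θ ((((g * ⟨circleDiagonal 3 ((fun i => z₀ i * Circle.exp (![(1 : ℝ), 0, -1] i * ψ)) ∘ ⇑ρ), circleDiagonal_mem_archLocal_diagonal L 3 α w _⟩ * g⁻¹ :
                archLocal L 3 (Matrix.diagonal α) w) : GL (Fin 3) ℂ) : Matrix (Fin 3) (Fin 3) ℂ)) ∂ν) ψ) ∧
          Tendsto (fun ψ : ℝ => deriv (fun ψ : ℝ => (2 * Real.sin ψ : ℂ) * ∫ g : archLocal L 3 (Matrix.diagonal α) w,
              Θ ((((g * ⟨circleDiagonal 3 ((fun i => z₀ i * Circle.exp (![(1 : ℝ), 0, -1] i * ψ)) ∘ ⇑ρ), circleDiagonal_mem_archLocal_diagonal L 3 α w _⟩ * g⁻¹ :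
                archLocal L 3 (Matrix.diagonal α) w) : GL (Fin 3) ℂ) : Matrix (Fin 3) (Fin 3) ℂ)) ∂ν) ψ)
            (𝓝[>] 0)
            (𝓝 (
                c * ∫ y, descConj (⟨circleDiagonal 3 z₀, circleDiagonal_mem_archLocal_diagonal L 3 (α ∘ ⇑ρ⁻¹) w z₀⟩ : archLocal L 3 (Matrix.diagonal (α ∘ ⇑ρ⁻¹)) w)
                  (Subgroup.centralizer ({(⟨circleDiagonal 3 z₁, circleDiagonal_mem_archLocal_diagonal L 3 (α ∘ ⇑ρ⁻¹) w z₁⟩ :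
                    archLocal L 3 (Matrix.diagonal (α ∘ ⇑ρ⁻¹)) w)} : Set (archLocal L 3 (Matrix.diagonal (α ∘ ⇑ρ⁻¹)) w)))
                  (forall_mem_centralizer_circleDiagonal_comm_of_wall L (α ∘ ⇑ρ⁻¹) w h02 h01 h02' h01')
                  (fun k : archLocal L 3 (Matrix.diagonal (α ∘ ⇑ρ⁻¹)) w =>
                    Θ ((monomial ρ⁻¹ fun _ : Fin 3 => (1 : ℂ)) * ((k : GL (Fin 3) ℂ) : Matrix (Fin 3) (Fin 3) ℂ) *
                      (((Matrix.GeneralLinearGroup.mkOfDetNeZero _ (det_monomial_one_ne_zero 3 ρ⁻¹))⁻¹ : GL (Fin 3) ℂ) : Matrix (Fin 3) (Fin 3) ℂ))) y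
                  ∂(quotientMeasure _ νH (isClosed_coe_centralizer_singleton _)
                    (ν.map (ContinuousMulEquiv.restrictSubgroup (GLn.conjEquiv (Matrix.GeneralLinearGroup.mkOfDetNeZero _ (det_monomial_one_ne_zero 3 ρ⁻¹)))
                      (archLocal L 3 (Matrix.diagonal (α ∘ ⇑ρ⁻¹)) w) (archLocal L 3 (Matrix.diagonal α) w)
                      (mem_archLocal_comp_perm_iff_conj_mem L 3 α w ρ⁻¹)).symm)))) := by
  classical
  haveI hLC : LocallyCompactSpace (archLocal L 3 (Matrix.diagonal (α ∘ ⇑ρ⁻¹)) w) := locallyCompactSpace_archLocal L 3 (Matrix.diagonal (α ∘ ⇑ρ⁻¹)) w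
  haveI hSC : SecondCountableTopology (archLocal L 3 (Matrix.diagonal (α ∘ ⇑ρ⁻¹)) w) := secondCountableTopology_archLocal L 3 (Matrix.diagonal (α ∘ ⇑ρ⁻¹)) w
  haveI hRI : (ν.map (ContinuousMulEquiv.restrictSubgroup (GLn.conjEquiv (Matrix.GeneralLinearGroup.mkOfDetNeZero _ (det_monomial_one_ne_zero 3 ρ⁻¹)))
      (archLocal L 3 (Matrix.diagonal (α ∘ ⇑ρ⁻¹)) w) (archLocal L 3 (Matrix.diagonal α) w)
      (mem_archLocal_comp_perm_iff_conj_mem L 3 α w ρ⁻¹)).symm).IsMulRightInvariant := isMulRightInvariant_map_relabel_symm L 3 α w ρ⁻¹ ν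
  -- the letter on the relabelled group `G_w(α ∘ ρ⁻¹)` (NONCOMPACT `{0,2}`-wall), fed with the transported Haar measure and `νH`
  obtain ⟨c, hc0, hc⟩ := (archLimitFormulaNoncompactWall_holds L (α ∘ ⇑ρ⁻¹) w) (fun i => hα (ρ⁻¹ i)) (fun i => hreal (ρ⁻¹ i))
      (ν.map (ContinuousMulEquiv.restrictSubgroup (GLn.conjEquiv (Matrix.GeneralLinearGroup.mkOfDetNeZero _ (det_monomial_one_ne_zero 3 ρ⁻¹)))
        (archLocal L 3 (Matrix.diagonal (α ∘ ⇑ρ⁻¹)) w) (archLocal L 3 (Matrix.diagonal α) w)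
        (mem_archLocal_comp_perm_iff_conj_mem L 3 α w ρ⁻¹)).symm) z₁ h02 h01 hρ νH
  refine ⟨c, hc0, ?_⟩
  intro Θ hΘ hΘc z₀ h02' h01'
  have hΘ1 : ContDiff ℝ 1 Θ := hΘ.of_le (by exact_mod_cast le_top)
  refine ⟨fun ψ hψ => ((((Real.hasDerivAt_sin ψ).ofReal_comp).const_mul (2 : ℂ)).differentiableAt).mul
    (differentiableAt_integral_comp_conj_splitCurve_comp_perm L α w hα hreal ν Θ hΘ1 hΘc z₀ ρ hψ), ?_⟩
  -- the term of `ρ`, in normal form on `G_w(α ∘ ρ⁻¹)`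
  rw [sin_mul_integral_comp_conj_splitCurve_comp_perm_eq L α w ν Θ z₀ ρ]
  have hΘ' := contDiff_comp_monomial_conj 3 ρ⁻¹ Θ hΘ
  have hΘ'1 : ContDiff ℝ 1 (fun A : Matrix (Fin 3) (Fin 3) ℂ => Θ ((monomial ρ⁻¹ fun _ : Fin 3 => (1 : ℂ)) * A *
      (((Matrix.GeneralLinearGroup.mkOfDetNeZero _ (det_monomial_one_ne_zero 3 ρ⁻¹))⁻¹ : GL (Fin 3) ℂ) : Matrix (Fin 3) (Fin 3) ℂ))) :=
    hΘ'.of_le (by exact_mod_cast le_top)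
  have hΘ'c := hasCompactSupport_comp_relabel L 3 α w ρ⁻¹ Θ hΘc
  -- NONCOMPACT wall: the LETTER on `G_w(α ∘ ρ⁻¹)`
  exact (hc _ hΘ' hΘ'c z₀ h02' h01').mono_left (nhdsWithin_mono (0 : ℝ) fun x hx => Set.mem_compl_singleton_iff.mpr (ne_of_gt hx))

omit [NumberField L] [IsCMField L] in
/-- **THE WALL JUMP OF ONE COMPACT PARTNER**: if the `w`-wall `{ρ⁻¹0, ρ⁻¹2}` of the relabelling `ρ` is COMPACT (same-sign slots), then along the one-angle curve
`∂_ψ[2 sin ψ · F_Θ(z_ψ∘ρ)] → 2 · F_Θ(z₀∘ρ)` as `ψ → 0+` (★ (J-cw) `tendsto_deriv_sin_smul_integral_compactWall` on the relabelled group, ★ `sin_mul_integral_comp_conj_splitCurve_comp_perm_eq`),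
and the function is differentiable at every regular parameter.  Print's `γ₂ → γ₀′` («`e(γ₀′) = −1`», the compact inner form), p. 118. [cite: Rogawski1990, §8.2 pp. 118, 122–124] -/
theorem tendsto_deriv_wallJump_partner_compact
    (hα : ∀ i, α i ≠ 0) (hreal : ∀ i, (w.1.embedding (α i)).im = 0)
    (ν : Measure (archLocal L 3 (Matrix.diagonal α) w)) [ν.IsHaarMeasure] [ν.IsMulRightInvariant]
    (Θ : Matrix (Fin 3) (Fin 3) ℂ → ℂ) (hΘ : ContDiff ℝ (⊤ : ℕ∞) Θ)
    (hΘc : HasCompactSupport (fun k : archLocal L 3 (Matrix.diagonal α) w => Θ ((k : GL (Fin 3) ℂ) : Matrix (Fin 3) (Fin 3) ℂ)))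
    (z₀ : Fin 3 → Circle) (h02' : z₀ 0 = z₀ 2) (h01' : z₀ 0 ≠ z₀ 1) (ρ : Perm (Fin 3))
    (hρ : 0 < (w.1.embedding (α (ρ⁻¹ 0))).re * (w.1.embedding (α (ρ⁻¹ 2))).re) :
    (∀ ψ : ℝ, Function.Injective (fun i => z₀ i * Circle.exp (![(1 : ℝ), 0, -1] i * ψ)) → DifferentiableAt ℝ (fun ψ : ℝ => (2 * Real.sin ψ : ℂ) * ∫ g : archLocal L 3 (Matrix.diagonal α) w,
              Θ ((((g * ⟨circleDiagonal 3 ((fun i => z₀ i * Circle.exp (![(1 : ℝ), 0, -1] i * ψ)) ∘ ⇑ρ), circleDiagonal_mem_archLocal_diagonal L 3 α w _⟩ * g⁻¹ :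
                archLocal L 3 (Matrix.diagonal α) w) : GL (Fin 3) ℂ) : Matrix (Fin 3) (Fin 3) ℂ)) ∂ν) ψ) ∧
    Tendsto (fun ψ : ℝ => deriv (fun ψ : ℝ => (2 * Real.sin ψ : ℂ) * ∫ g : archLocal L 3 (Matrix.diagonal α) w,
              Θ ((((g * ⟨circleDiagonal 3 ((fun i => z₀ i * Circle.exp (![(1 : ℝ), 0, -1] i * ψ)) ∘ ⇑ρ), circleDiagonal_mem_archLocal_diagonal L 3 α w _⟩ * g⁻¹ :
                archLocal L 3 (Matrix.diagonal α) w) : GL (Fin 3) ℂ) : Matrix (Fin 3) (Fin 3) ℂ)) ∂ν) ψ) (𝓝[>] 0)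
      (𝓝 (2 * ∫ g : archLocal L 3 (Matrix.diagonal α) w,
        Θ ((((g * ⟨circleDiagonal 3 (z₀ ∘ ⇑ρ), circleDiagonal_mem_archLocal_diagonal L 3 α w _⟩ * g⁻¹ :
          archLocal L 3 (Matrix.diagonal α) w) : GL (Fin 3) ℂ) : Matrix (Fin 3) (Fin 3) ℂ)) ∂ν)) := by
  have hΘ1 : ContDiff ℝ 1 Θ := hΘ.of_le (by exact_mod_cast le_top)
  have h12' : z₀ 1 ≠ z₀ 2 := fun h => h01' (h02'.trans h.symm)
  refine ⟨fun ψ hψ => ((((Real.hasDerivAt_sin ψ).ofReal_comp).const_mul (2 : ℂ)).differentiableAt).mul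
    (differentiableAt_integral_comp_conj_splitCurve_comp_perm L α w hα hreal ν Θ hΘ1 hΘc z₀ ρ hψ), ?_⟩
  -- the term of `ρ`, in normal form on `G_w(α ∘ ρ⁻¹)`; ★ (J-cw) there, read back through the transport at `ψ = 0`
  rw [sin_mul_integral_comp_conj_splitCurve_comp_perm_eq L α w ν Θ z₀ ρ]
  have hΘ' := contDiff_comp_monomial_conj 3 ρ⁻¹ Θ hΘ
  have hΘ'1 : ContDiff ℝ 1 (fun A : Matrix (Fin 3) (Fin 3) ℂ => Θ ((monomial ρ⁻¹ fun _ : Fin 3 => (1 : ℂ)) * A *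
      (((Matrix.GeneralLinearGroup.mkOfDetNeZero _ (det_monomial_one_ne_zero 3 ρ⁻¹))⁻¹ : GL (Fin 3) ℂ) : Matrix (Fin 3) (Fin 3) ℂ))) :=
    hΘ'.of_le (by exact_mod_cast le_top)
  have hΘ'c := hasCompactSupport_comp_relabel L 3 α w ρ⁻¹ Θ hΘc
  rw [integral_comp_conj_circleDiagonal_comp_perm_eq_integral_ambient' L 3 α w ρ ν Θ z₀]
  have hcw := tendsto_deriv_sin_smul_integral_compactWall L (α ∘ ⇑ρ⁻¹) w
    (ν.map (ContinuousMulEquiv.restrictSubgroup (GLn.conjEquiv (Matrix.GeneralLinearGroup.mkOfDetNeZero _ (det_monomial_one_ne_zero 3 ρ⁻¹)))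
      (archLocal L 3 (Matrix.diagonal (α ∘ ⇑ρ⁻¹)) w) (archLocal L 3 (Matrix.diagonal α) w)
      (mem_archLocal_comp_perm_iff_conj_mem L 3 α w ρ⁻¹)).symm)
    (fun i => hα (ρ⁻¹ i)) (fun i => hreal (ρ⁻¹ i)) hρ _ hΘ'1 hΘ'c h01' h12'
  simp only [Complex.real_smul, Complex.ofReal_mul, Complex.ofReal_ofNat] at hcw
  exact tendsto_nhdsWithin_of_tendsto_nhds hcw

end Junction

end Summit.HodgeConjecture.HodgeConjecture.Cruxes.H413.K2E4ArchPartnerWallJump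

end
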